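import Literature.Analysis.FluidPDE.AxisymmetricTypeIData
import Literature.Analysis.FluidPDE.NormalisedPressureDischarge
import Literature.Analysis.FluidPDE.SuitableWeakPressure
import HarnessLib

/-!
# The pressure gauge of `axisymmetric_typeI_bounded`: the normalised pressure as an admissible
# pressure below the final time

Analysis/FluidPDE proofs-layer file (theorems only), sequel of `AxisymmetricTypeIData.lean` on the
decomposition path of `Literature.Analysis.FluidPDE.knss_no_axisymmetric_typeI` through the local
inputs of `AxisymmetricTypeIBounded.lean`. Those inputs are printed for suitable weak solutions
`(v, q)` on backward cylinders whose top time is the final time `T`, with `q ∈ L^{3/2}` of the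
cylinder; the classical pressure `p` of `AxisymmetricTypeIHyp ν T u p` is determined only up to a
function of time, which may blow up at `T`, so it cannot serve as `q`. Tao's pressure
normalisation (Tao 2011, Lemma 4.1 (i), PROVED in the tree as `tao_pressure_normalisation_holds`:
on every closed slab `[0, T'] × ℝ³`, `p(t, ·) = p̃[u(t)] + C_{T'}(t)` for a.e. `t`, `C_{T'}`
bounded measurable, `p̃` the normalised pressure `-Δ⁻¹∂ᵢ∂ⱼ(uᵢuⱼ)`) supplies the canonical gauge:

* `AxisymmetricTypeIHyp.exists_pressure_gauge` — the function `c(t) = p(t, 0) − p̃[u(t)](0)`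
  satisfies `p(t, ·) − c(t) = p̃[u(t)]` for a.e. `t ∈ (0, T)`, and agrees a.e. on every `[0, T']`,
  `T' < T`, with a bounded measurable function;
* `AxisymmetricTypeIHyp.isSuitableWeakSolutionOn_sub_gauge` — `(u, p − c)` is a suitable weak
  solution on every open `Q ⊆ (0, T) × ℝ³` (accepted `IsSuitableWeakSolutionOn.sub_pressure`: the
  pressure of a suitable weak solution is determined only up to a locally `L^{3/2}` function of
  time; `c` is such on `Q`, every compact subset of which stays below some `T' < T`);
* `AxisymmetricTypeIHyp.exists_gauged_pressure` — packaging: a pressure `q`, a.e. in time equal to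
  `p̃[u(t)]`, jointly a.e. strongly measurable on `(0, T) × ℝ³`, with `(u, q)` suitable on every open
  region below `T`.

The `L^{3/2}` integrability of `q = p̃[u]` on cylinders reaching `T` (from the Type I rate, the
energy, and the `L²` bound `eLpNorm_normalisedPressure_le_of_integrable`) is the next file.

## References

* T. Tao, *Localisation and compactness properties of the Navier–Stokes global regularity
  problem*, Anal. PDE 6 (2013), Lemma 4.1 (i), (40). [Tao2011]
* L. Caffarelli, R. Kohn, L. Nirenberg, Comm. Pure Appl. Math. 35 (1982), §2 (the pressure gauge
  in (2.2), (2.5)). [CaffarelliKohnNirenberg1982]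
-/

noncomputable section

open MeasureTheory Set Function Filter Topology TopologicalSpace Metric
open scoped NNReal ENNReal

namespace Literature.Analysis.FluidPDE

/-- Local notation for physical space `ℝ³ = EuclideanSpace ℝ (Fin 3)`. -/
local notation "ℝ³" => EuclideanSpace ℝ (Fin 3)

/-! ### Measure-theoretic helpers on slabs -/

/-- A property of the time coordinate holding for a.e. `t ∈ I` holds a.e. on the slab `I × ℝ³`
(the exceptional set `N × ℝ³`, `|N| = 0`, is null for the product measure). [folklore] -/
theorem ae_restrict_prod_univ_of_ae_restrict {I : Set ℝ} (hI : MeasurableSet I) {P : ℝ → Prop}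
    (h : ∀ᵐ t ∂(volume.restrict I), P t) :
    ∀ᵐ z ∂((volume : Measure (ℝ × ℝ³)).restrict (I ×ˢ (univ : Set ℝ³))), P z.1 := by
  rw [ae_restrict_iff' hI, ae_iff] at h
  rw [ae_restrict_iff' (hI.prod MeasurableSet.univ), ae_iff]
  have hsub : {z : ℝ × ℝ³ | ¬(z ∈ I ×ˢ (univ : Set ℝ³) → P z.1)} ⊆
      {t : ℝ | ¬(t ∈ I → P t)} ×ˢ (univ : Set ℝ³) := by
    intro z hz
    simp only [mem_setOf_eq, mem_prod, mem_univ, and_true, Classical.not_imp] at hz ⊢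
    exact hz
  refine measure_mono_null hsub ?_
  rw [Measure.volume_eq_prod, Measure.prod_prod, h, zero_mul]

/-- A compact subset of the open slab `(0, T) × ℝ³` stays below some `T' < T` and above `0`:
`K ⊆ [0, T'] × ℝ³`. [folklore] -/
theorem exists_subset_Icc_prod_of_isCompact {T : ℝ} {K : Set (ℝ × ℝ³)} (hK : IsCompact K)
    (hKQ : K ⊆ Ioo 0 T ×ˢ (univ : Set ℝ³)) (hT : 0 < T) :
    ∃ T' ∈ Ioo 0 T, K ⊆ Icc 0 T' ×ˢ (univ : Set ℝ³) := by
  rcases K.eq_empty_or_nonempty with rfl | hne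
  · exact ⟨T / 2, ⟨by linarith, by linarith⟩, empty_subset _⟩
  · obtain ⟨z₀, hz₀, hmax⟩ := hK.exists_isMaxOn hne continuous_fst.continuousOn
    have hz₀T : z₀.1 ∈ Ioo 0 T := (hKQ hz₀).1
    exact ⟨z₀.1, hz₀T, fun z hz => ⟨⟨(hKQ hz).1.1.le, hmax hz⟩, mem_univ _⟩⟩

/-- A function of time, a.e. equal on `[0, T']` to a bounded measurable function, is integrable
on every compact `K ⊆ [0, T'] × ℝ³` and has finite `L^{3/2}` mass there. [folklore] -/
theorem integrableOn_and_lintegral_lt_top_of_ae_eq {T' : ℝ} {c C : ℝ → ℝ} {M : ℝ}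
    (hCm : Measurable C) (hCb : ∀ t, |C t| ≤ M)
    (hae : ∀ᵐ t ∂(volume.restrict (Icc 0 T')), c t = C t) {K : Set (ℝ × ℝ³)} (hK : IsCompact K)
    (hKsub : K ⊆ Icc 0 T' ×ˢ (univ : Set ℝ³)) :
    IntegrableOn (fun z : ℝ × ℝ³ => c z.1) K volume ∧
      ∫⁻ z in K, ‖c z.1‖ₑ ^ (3 / 2 : ℝ) < ∞ := by
  have hM : 0 ≤ M := (abs_nonneg _).trans (hCb 0)
  -- a.e. equality on `K`
  have haeK : ∀ᵐ z ∂((volume : Measure (ℝ × ℝ³)).restrict K), c z.1 = C z.1 :=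
    ae_restrict_of_ae_restrict_of_subset hKsub
      (ae_restrict_prod_univ_of_ae_restrict measurableSet_Icc hae)
  have haeK' : (fun z : ℝ × ℝ³ => C z.1) =ᵐ[(volume : Measure (ℝ × ℝ³)).restrict K]
      fun z => c z.1 := by
    filter_upwards [haeK] with z hz using hz.symm
  have hKfin : volume K < ∞ := hK.measure_lt_top
  have hCint : IntegrableOn (fun z : ℝ × ℝ³ => C z.1) K volume :=
    Measure.integrableOn_of_bounded hKfin.ne (hCm.comp measurable_fst).aestronglyMeasurable
      (Eventually.of_forall fun z => by rw [Real.norm_eq_abs]; exact hCb z.1)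
  refine ⟨hCint.congr_fun_ae haeK', ?_⟩
  calc ∫⁻ z in K, ‖c z.1‖ₑ ^ (3 / 2 : ℝ) = ∫⁻ z in K, ‖C z.1‖ₑ ^ (3 / 2 : ℝ) :=
        lintegral_congr_ae (by filter_upwards [haeK] with z hz; rw [hz])
    _ ≤ ∫⁻ _ in K, ENNReal.ofReal M ^ (3 / 2 : ℝ) := by
        refine lintegral_mono fun z => ENNReal.rpow_le_rpow ?_ (by norm_num)
        rw [← ofReal_norm, Real.norm_eq_abs]
        exact ENNReal.ofReal_le_ofReal (hCb z.1)
    _ < ∞ := by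
        rw [setLIntegral_const]
        exact ENNReal.mul_lt_top (ENNReal.rpow_lt_top_of_nonneg (by norm_num) ENNReal.ofReal_ne_top)
          hKfin

/-- The open interval `(0, T)`, `T > 0`, is the countable union of the intervals
`(0, T − T/(n+2)]`. [folklore] -/
theorem iUnion_Ioc_sub_div_eq_Ioo {T : ℝ} (hT : 0 < T) :
    ⋃ n : ℕ, Ioc (0 : ℝ) (T - T / ((n : ℝ) + 2)) = Ioo 0 T := by
  ext t
  simp only [mem_iUnion, mem_Ioc, mem_Ioo]
  constructor
  · rintro ⟨n, h0, h1⟩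
    have : 0 < T / ((n : ℝ) + 2) := by positivity
    exact ⟨h0, by linarith⟩
  · rintro ⟨h0, h1⟩
    obtain ⟨n, hn⟩ := exists_nat_ge (T / (T - t))
    refine ⟨n, h0, ?_⟩
    have hTt : 0 < T - t := sub_pos.2 h1
    have h2 : T / ((n : ℝ) + 2) ≤ T - t := by
      rw [div_le_iff₀ (by positivity)]
      have h3 : T / (T - t) * (T - t) = T := div_mul_cancel₀ T hTt.ne'
      nlinarith [hn, hTt]
    linarith

namespace AxisymmetricTypeIHyp

variable {ν T : ℝ} {u : ℝ → ℝ³ → ℝ³} {p : ℝ → ℝ³ → ℝ}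

/-! ### The gauge -/

/-- **The pressure gauge.** With `c(t) = p(t, 0) − p̃[u(t)](0)`: (i) `p(t, ·) − c(t) = p̃[u(t)]`
for a.e. `t ∈ (0, T)`; (ii) for every `T' < T`, `c` agrees a.e. on `[0, T']` with a bounded
measurable function (Tao 2011, Lemma 4.1 (i) on the closed slab `[0, T']`, through the proved
`tao_pressure_normalisation_holds`: `p = p̃[u] + C_{T'}` a.e. in `t`, so `c = C_{T'}` a.e.).
[cite: Tao2011, Lemma 4.1 (i)] -/
theorem exists_pressure_gauge (H : AxisymmetricTypeIHyp ν T u p) :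
    (∀ᵐ t ∂(volume.restrict (Ioo 0 T)), ∀ x,
        p t x - (p t 0 - normalisedPressure (u t) 0) = normalisedPressure (u t) x) ∧
      ∀ T' < T, ∃ (C : ℝ → ℝ) (M : ℝ), Measurable C ∧ (∀ t, |C t| ≤ M) ∧
        ∀ᵐ t ∂(volume.restrict (Icc 0 T')), p t 0 - normalisedPressure (u t) 0 = C t := by
  have hT := H.time_pos
  -- Tao's normalisation on each closed slab `[0, T']`, `0 < T' < T`
  have key : ∀ T' ∈ Ioo 0 T, ∃ (C : ℝ → ℝ) (M : ℝ), Measurable C ∧ (∀ t, |C t| ≤ M) ∧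
      ∀ᵐ t ∂(volume.restrict (Icc 0 T')), ∀ x, p t x = normalisedPressure (u t) x + C t := by
    intro T' hT'
    have hsol : IsClassicalNSSolutionOn (Icc 0 T') ν 0 u p :=
      H.classical.mono (Icc_subset_Ico_right hT'.2) (uniqueDiffOn_Icc hT'.1)
    have hEn : ∃ Cₑ : ℝ≥0∞, Cₑ < ⊤ ∧ ∀ t ∈ Icc 0 T', ∫⁻ x, ‖u t x‖ₑ ^ 2 ≤ Cₑ :=
      ⟨ENNReal.ofReal (2 * VectorCalculus.kineticEnergy (u 0)), ENNReal.ofReal_lt_top,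
        fun t ht => H.eEnergy_le ⟨ht.1, ht.2.trans_lt hT'.2⟩⟩
    obtain ⟨C, hCm, ⟨M, hM⟩, hae⟩ := tao_pressure_normalisation_holds ν T' H.viscosity_pos hT'.1
      u p hsol hEn
    -- make the bound global by cutting `C` off outside `[0, T']`
    refine ⟨(Icc 0 T').indicator C, max M 0, hCm.indicator measurableSet_Icc, fun t => ?_, ?_⟩
    · by_cases ht : t ∈ Icc 0 T'
      · rw [indicator_of_mem ht]; exact (hM t ht).trans (le_max_left _ _)
      · rw [indicator_of_notMem ht, abs_zero]; exact le_max_right _ _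
    · filter_upwards [hae, ae_restrict_mem measurableSet_Icc] with t ht htI x
      rw [indicator_of_mem htI]
      exact ht x
  refine ⟨?_, fun T' hT'T => ?_⟩
  · -- (i) a.e. on `(0, T)` through the cover by `(0, T − T/(n+2)]`
    rw [← iUnion_Ioc_sub_div_eq_Ioo hT, ae_restrict_iUnion_iff]
    intro n
    have hT'mem : T - T / ((n : ℝ) + 2) ∈ Ioo 0 T := by
      constructor
      · have h1 : T / ((n : ℝ) + 2) < T := by
          rw [div_lt_iff₀ (by positivity)]; nlinarith
        linarith
      · have : 0 < T / ((n : ℝ) + 2) := by positivity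
        linarith
    obtain ⟨C, M, -, -, hae⟩ := key _ hT'mem
    refine ae_restrict_of_ae_restrict_of_subset Ioc_subset_Icc_self ?_
    filter_upwards [hae] with t ht x
    rw [ht x, ht 0]
    ring
  · -- (ii) on `[0, T']`
    rcases le_or_gt T' 0 with hT'0 | hT'0
    · refine ⟨0, 0, measurable_const, fun t => by simp, ?_⟩
      have hnull : volume (Icc (0 : ℝ) T') = 0 := by
        rw [Real.volume_Icc, sub_zero, ENNReal.ofReal_eq_zero]
        exact hT'0
      rw [Measure.restrict_eq_zero.2 hnull, ae_zero]
      exact Filter.eventually_bot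
    · obtain ⟨C, M, hCm, hCb, hae⟩ := key T' ⟨hT'0, hT'T⟩
      refine ⟨C, M, hCm, hCb, ?_⟩
      filter_upwards [hae] with t ht
      rw [ht 0]
      ring

/-- **`(u, p − c)` is a suitable weak solution on every open region below the final time**, for
the gauge `c(t) = p(t, 0) − p̃[u(t)](0)` (accepted `IsSuitableWeakSolutionOn.sub_pressure`: the
extra terms `∫ c(t) ∫ div ψ` and `∫ c(t) ∫ ⟪u, ∇φ⟫` vanish; `c` is locally integrable and locally
`L^{3/2}` on `Q` because every compact subset of `Q` stays below some `T' < T`, where `c` agrees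
a.e. with a bounded measurable function). [cite: CaffarelliKohnNirenberg1982, §2] -/
theorem isSuitableWeakSolutionOn_sub_gauge (H : AxisymmetricTypeIHyp ν T u p)
    (Q : Opens (ℝ × ℝ³)) (hQ : (Q : Set (ℝ × ℝ³)) ⊆ Ioo 0 T ×ˢ univ) :
    IsSuitableWeakSolutionOn Q ν 0 u fun t x => p t x - (p t 0 - normalisedPressure (u t) 0) := by
  obtain ⟨-, hloc⟩ := H.exists_pressure_gauge
  set c : ℝ → ℝ := fun t => p t 0 - normalisedPressure (u t) 0 with hc
  -- local integrability and local `L^{3/2}` of `(t, x) ↦ c t` on `Q`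
  have hpiece : ∀ K ⊆ (Q : Set (ℝ × ℝ³)), IsCompact K →
      IntegrableOn (fun z : ℝ × ℝ³ => c z.1) K volume ∧ ∫⁻ z in K, ‖c z.1‖ₑ ^ (3 / 2 : ℝ) < ∞ := by
    intro K hKQ hK
    obtain ⟨T', hT', hKsub⟩ := exists_subset_Icc_prod_of_isCompact hK (hKQ.trans hQ) H.time_pos
    obtain ⟨C, M, hCm, hCb, hae⟩ := hloc T' hT'.2
    exact integrableOn_and_lintegral_lt_top_of_ae_eq hCm hCb hae hK hKsub
  have hli : LocallyIntegrableOn (fun z : ℝ × ℝ³ => c z.1) (Q : Set (ℝ × ℝ³)) volume :=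
    (locallyIntegrableOn_iff Q.isOpen.isLocallyClosed).2 fun K hKQ hK => (hpiece K hKQ hK).1
  exact (H.isSuitableWeakSolutionOn Q hQ).sub_pressure hli fun K hKQ hK => (hpiece K hKQ hK).2

/-- **A gauged pressure below the final time.** Under the standing hypotheses there is a pressure
`q` with: `(u, q)` a suitable weak solution on every open `Q ⊆ (0, T) × ℝ³`; `q(t, ·) = p̃[u(t)]`
(the normalised pressure) for a.e. `t ∈ (0, T)`; and `q` jointly a.e. strongly measurable on
`(0, T) × ℝ³`. (Take `q = p − c` with the gauge `c`.) [cite: Tao2011, Lemma 4.1 (i)] -/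
theorem exists_gauged_pressure (H : AxisymmetricTypeIHyp ν T u p) :
    ∃ q : ℝ → ℝ³ → ℝ,
      (∀ Q : Opens (ℝ × ℝ³), (Q : Set (ℝ × ℝ³)) ⊆ Ioo 0 T ×ˢ univ →
        IsSuitableWeakSolutionOn Q ν 0 u q) ∧
      (∀ᵐ t ∂(volume.restrict (Ioo 0 T)), q t = normalisedPressure (u t)) ∧
      AEStronglyMeasurable (uncurry q) ((volume : Measure (ℝ × ℝ³)).restrict (Ioo 0 T ×ˢ univ)) := by
  obtain ⟨hae, hloc⟩ := H.exists_pressure_gauge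
  set c : ℝ → ℝ := fun t => p t 0 - normalisedPressure (u t) 0 with hc
  refine ⟨fun t x => p t x - c t, fun Q hQ => H.isSuitableWeakSolutionOn_sub_gauge Q hQ, ?_, ?_⟩
  · filter_upwards [hae] with t ht
    exact funext fun x => ht x
  · -- measurability: `p` is continuous on the open slab, `c` is a.e. equal to a measurable
    -- function on each `(0, T − T/(n+2)] × ℝ³`
    have hT := H.time_pos
    have hp : AEStronglyMeasurable (uncurry p)
        ((volume : Measure (ℝ × ℝ³)).restrict (Ioo 0 T ×ˢ univ)) :=
      H.classical_Ioo.smooth_pressure.continuousOn.aestronglyMeasurable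
        (measurableSet_Ioo.prod MeasurableSet.univ)
    have hcm : AEStronglyMeasurable (fun z : ℝ × ℝ³ => c z.1)
        ((volume : Measure (ℝ × ℝ³)).restrict (Ioo 0 T ×ˢ univ)) := by
      rw [← iUnion_Ioc_sub_div_eq_Ioo hT, iUnion_prod_const, aestronglyMeasurable_iUnion_iff]
      intro n
      have hlt : T - T / ((n : ℝ) + 2) < T := by
        have : 0 < T / ((n : ℝ) + 2) := by positivity
        linarith
      obtain ⟨C, M, hCm, -, haeC⟩ := hloc _ hlt
      have h1 : ∀ᵐ z ∂((volume : Measure (ℝ × ℝ³)).restrict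
          (Ioc 0 (T - T / ((n : ℝ) + 2)) ×ˢ (univ : Set ℝ³))), c z.1 = C z.1 :=
        ae_restrict_of_ae_restrict_of_subset (prod_mono Ioc_subset_Icc_self Subset.rfl)
          (ae_restrict_prod_univ_of_ae_restrict measurableSet_Icc haeC)
      refine (hCm.comp measurable_fst).aestronglyMeasurable.congr ?_
      filter_upwards [h1] with z hz using hz.symm
    have e : uncurry (fun t x => p t x - c t) = fun z => uncurry p z - c z.1 := by
      funext z; rfl
    rw [e]
    exact hp.sub hcm

end AxisymmetricTypeIHyp

end Literature.Analysis.FluidPDE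

end
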